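import Summits.BirchSwinnertonDyer.BirchSwinnertonDyer.Theorems.ThetaPartnerAtTwoSignedMainConjectureCMTwoRankZeroKatoDescentSnake
import Mathlib.RingTheory.Ideal.AssociatedPrime.Finiteness
import Mathlib.RingTheory.Ideal.Height
import Mathlib.RingTheory.Ideal.KrullsHeightTheorem
import Mathlib.RingTheory.SimpleModule.Basic
import HarnessLib

/-!
# Kato's descent (Astérisque 295, Lemma 14.15 / 15.13) — file 2/3: `Φ_a` and Kato's Lemma 14.15 in
# a Noetherian local domain of dimension `≤ 2`, as a LENGTH identity

Helper file for crux K2R0P♭ `stmt-BirchSwinnertonDyer-26471`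
(`Summit.BirchSwinnertonDyer.BirchSwinnertonDyer.Theses.ThetaPartnerAtTwo.SignedMainConjectureCMTwoRankZeroOfPubOfFlat`,
route `ThetaPartnerAtTwo`, line `rankzero` v16, lead prover bsd-wall-tp2-p2 g9, 2026-08-28). Pure
commutative algebra, no carriers, no named fact, nothing about elliptic curves; BSD is not proved by
any of this. PURPOSE: clause (g) of the LOWER package (`ℓ_𝔭(𝐇¹(T~)/Λ z_A) ≤ ℓ_𝔭(X₀)`, port spec
LOWER-LENGTH-SOCKET-w2g2.md §5) descends from the two-variable equality on the `K(p^∞𝔣)`-tower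
(Johnson-Leung–Kings 2011, Thm. 5.7 with §7.2 "Proof for regular prime ideals", unconditional at
every height-one `𝔮 ∌ p`) through Kato's Lemma 15.13 (Astérisque 295, p. 264: `A = O_λ⟦G_{p^∞𝔣}⟧_𝔮`
is a regular local ring of dimension `2`, the kernel of `A → O_λ⟦G_∞⟧_𝔭` is principal `= (a)`,
(15.13.1) `H²_𝔮/aH²_𝔮 ≅ H²(T~)_𝔭`, (15.13.2) `0 → H¹_𝔮/aH¹_𝔮 → H¹(T~)_𝔭 → H²_𝔮[a] → 0`) and
Kato's Lemma 14.15 (p. 243–244). Kato himself (Prop. 15.17) descends only the Euler-system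
inequality; the reverse inequality needed here uses ONE further printed input, Kato Thm. 12.4 (2)
(`𝐇¹(T~)` is torsion free, all `p`; for CM forms by 15.15), in the form "`Ann_A(z~) ⊆ (a)`".

## Contents of this file (all PROVED, Mathlib + the tree's `Module.lengthAt`; theorem-only)
* `Φ_a` (defined in file 1/3): finite support, additivity in short exact sequences, invariance,
  `Φ_a(A/𝔭) = ℓ_A(A/(𝔭 + aA))`, monotonicity.
* `length_quotSMulTop_eq_length_tors_add_Phi` : **Kato's Lemma 14.15** for a Noetherian local domain
  of dimension `≤ 2`: for `M` finitely generated torsion with `M_𝔮 = 0` at every height-one `𝔮 ∋ a`,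
  `ℓ_A(M/aM) = ℓ_A(M[a]) + Φ_a(M)` and `ℓ_A(M[a]) < ∞` (dévissage over Mathlib's prime filtration
  `IsNoetherianRing.induction_on_isQuotientEquivQuotientPrime`, snake from file 1/3).
File 3/3 (`…KatoDescent`): the descent inequality.

## References
* K. Kato, *p-adic Hodge theory and values of zeta functions of modular forms*, Astérisque 295
  (2004), Lemma 14.15 (p. 243–244), Lemma 15.13, Prop. 15.17 (p. 264–265), Thm. 12.4 (2) (p. 221).
* J. Johnson-Leung, G. Kings, J. reine angew. Math. 653 (2011), Thm. 5.7, §7.2.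
-/

set_option autoImplicit false
set_option linter.dupNamespace false

noncomputable section

open scoped Classical Pointwise

universe u v

namespace Summit.BirchSwinnertonDyer.BirchSwinnertonDyer.Theorems.KatoDescent

open Literature.NumberTheory.EllipticCurves Literature.NumberTheory.EllipticCurves.Module

/-! ## §3 `Φ_a`: finite support, additivity, monotonicity -/

section Phi

variable {A : Type*} [CommRing A]

variable {a : A} {M M' M'' : Type*} [AddCommGroup M] [Module A M] [AddCommGroup M'] [Module A M']
  [AddCommGroup M''] [Module A M'']

/-- The support of `𝔮 ↦ phiTerm a M 𝔮` lies in the height-one support of `M`. [folklore] -/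
theorem support_phiTerm_subset (a : A) (M : Type*) [AddCommGroup M] [Module A M] :
    Function.support (phiTerm a M) ⊆ heightOneSupport A M := by
  intro 𝔮 h𝔮
  rw [Function.mem_support, phiTerm] at h𝔮
  split_ifs at h𝔮 with h1
  · exact ⟨h1, fun h0 ↦ h𝔮 (by rw [h0, zero_mul])⟩
  · exact absurd rfl h𝔮

/-- Over a Noetherian domain, a module killed by some `s ≠ 0` has finite height-one support (its
height-one support primes are minimal over `(s)`). [folklore] -/
theorem heightOneSupport_finite [IsNoetherianRing A] [IsDomain A] {s : A} (hs : s ≠ 0)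
    (hsM : Module.IsTorsionBy A M s) : (heightOneSupport A M).Finite := by
  have hfin : (PrimeSpectrum.asIdeal ⁻¹' (Ideal.span {s}).minimalPrimes :
      Set (PrimeSpectrum A)).Finite :=
    ((Ideal.span {s}).finite_minimalPrimes_of_isNoetherianRing).preimage
      fun _ _ _ _ h => PrimeSpectrum.ext h
  refine hfin.subset ?_
  rintro 𝔮 ⟨h1, hsupp⟩
  have hs𝔮 : s ∈ 𝔮.asIdeal := by
    by_contra hns
    exact hsupp (lengthAt_eq_zero_of_isTorsionBy hsM 𝔮 hns)
  haveI : 𝔮.asIdeal.FiniteHeight := by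
    rw [Ideal.finiteHeight_iff, h1]
    exact Or.inr ENat.one_ne_top
  refine Ideal.mem_minimalPrimes_of_height_eq ((Ideal.span_singleton_le_iff_mem _).mpr hs𝔮) ?_
  rw [h1]
  exact Ideal.one_le_height_span_singleton_of_mem_nonZeroDivisors
    (mem_nonZeroDivisors_of_ne_zero hs)

/-- Hence `phiTerm a M` has finite support for such `M`. [folklore] -/
theorem hasFiniteSupport_phiTerm [IsNoetherianRing A] [IsDomain A] {s : A} (hs : s ≠ 0)
    (hsM : Module.IsTorsionBy A M s) : Function.HasFiniteSupport (phiTerm a M) :=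
  (heightOneSupport_finite hs hsM).subset (support_phiTerm_subset a M)

/-- A killing element passes to submodules. [folklore] -/
theorem isTorsionBy_of_injective {s : A} (hsM : Module.IsTorsionBy A M s) (f : M' →ₗ[A] M)
    (hf : Function.Injective f) : Module.IsTorsionBy A M' s := fun x ↦
  hf (by rw [map_smul, map_zero]; exact hsM (x := f x))

/-- A killing element passes to quotients. [folklore] -/
theorem isTorsionBy_of_surjective {s : A} (hsM : Module.IsTorsionBy A M s) (g : M →ₗ[A] M'')
    (hg : Function.Surjective g) : Module.IsTorsionBy A M'' s := fun x ↦ by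
  obtain ⟨y, rfl⟩ := hg x
  rw [← map_smul, show s • y = 0 from hsM (x := y), map_zero]

/-- **Additivity of `Φ_a`** in short exact sequences `0 → M' → M → M'' → 0` of modules killed by
some `s ≠ 0` over a Noetherian domain (additivity of the local lengths, finiteness of the
height-one supports). [folklore] -/
theorem Phi_eq_add_of_exact [IsNoetherianRing A] [IsDomain A] {s : A} (hs : s ≠ 0)
    (hsM : Module.IsTorsionBy A M s) (f : M' →ₗ[A] M) (g : M →ₗ[A] M'')
    (hf : Function.Injective f) (hg : Function.Surjective g) (hfg : Function.Exact f g) :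
    Phi a M = Phi a M' + Phi a M'' := by
  unfold Phi
  rw [← finsum_add_distrib (hasFiniteSupport_phiTerm hs (isTorsionBy_of_injective hsM f hf))
    (hasFiniteSupport_phiTerm hs (isTorsionBy_of_surjective hsM g hg))]
  refine finsum_congr fun 𝔮 ↦ ?_
  simp only [phiTerm]
  split_ifs with h1
  · rw [lengthAt_eq_add_of_exact f g hf hg hfg 𝔮, add_mul]
  · rw [add_zero]

/-- `Φ_a` is invariant under linear equivalences. [folklore] -/
theorem Phi_eq_of_linearEquiv (e : M ≃ₗ[A] M') : Phi a M = Phi a M' := by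
  unfold Phi
  refine finsum_congr fun 𝔮 ↦ ?_
  simp only [phiTerm, lengthAt_eq_of_linearEquiv e 𝔮]

/-- `Φ_a(M) = 0` when `M` has no height-one support (e.g. `M = 0` or `M = A/𝔪` with
`ht 𝔪 ≠ 1`). [folklore] -/
theorem Phi_eq_zero_of_forall (h : ∀ 𝔮 : PrimeSpectrum A, 𝔮.asIdeal.height = 1 → lengthAt A M 𝔮 = 0) :
    Phi a M = 0 := by
  unfold Phi
  refine finsum_eq_zero_of_forall_eq_zero fun 𝔮 ↦ ?_
  simp only [phiTerm]
  split_ifs with h1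
  · rw [h 𝔮 h1, zero_mul]
  · rfl

/-- **`Φ_a(A/𝔭) = m_a(𝔭) = ℓ_A(A/(𝔭 + aA))` for a height-one prime `𝔭`** (the one cyclic module that
contributes in the dévissage): `ℓ_𝔭(A/𝔭) = 1` and `(A/𝔭)_𝔮 = 0` at every other height-one `𝔮`.
[cite: Kato2004Asterisque, Lemma 14.15, proof ((ii), p. 244)] -/
theorem Phi_quotient_prime {𝔭 : PrimeSpectrum A} (h𝔭 : 𝔭.asIdeal.height = 1) :
    Phi a (A ⧸ 𝔭.asIdeal) = mult a 𝔭 := by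
  unfold Phi
  rw [finsum_eq_single _ 𝔭]
  · rw [phiTerm, if_pos h𝔭, lengthAt_quotient_self, one_mul]
  · intro 𝔮 hne
    rw [phiTerm]
    split_ifs with h1
    · rw [lengthAt_quotient_eq_zero_of_not_le, zero_mul]
      intro hle
      haveI : 𝔭.asIdeal.FiniteHeight := by
        rw [Ideal.finiteHeight_iff, h𝔭]
        exact Or.inr ENat.one_ne_top
      exact hne (PrimeSpectrum.ext
        (Ideal.eq_of_le_of_height_le 𝔭.asIdeal hle (by rw [h𝔭, h1])).symm)
    · rfl

/-- **Monotonicity of `Φ_a`**: if `ℓ_𝔮(N) ≤ ℓ_𝔮(M)` at every height-one prime and `M` is killed by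
some `s ≠ 0` (Noetherian domain), then `Φ_a(N) ≤ Φ_a(M)`. [folklore] -/
theorem Phi_mono [IsNoetherianRing A] [IsDomain A] {N : Type*} [AddCommGroup N] [Module A N]
    {s : A} (hs : s ≠ 0) (hsM : Module.IsTorsionBy A M s)
    (h : ∀ 𝔮 : PrimeSpectrum A, 𝔮.asIdeal.height = 1 → lengthAt A N 𝔮 ≤ lengthAt A M 𝔮) :
    Phi a N ≤ Phi a M := by
  have hM := hasFiniteSupport_phiTerm (a := a) hs hsM
  have hle : phiTerm a N ≤ phiTerm a M := fun 𝔮 ↦ by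
    simp only [phiTerm]
    split_ifs with h1
    · exact mul_le_mul' (h 𝔮 h1) le_rfl
    · exact le_rfl
  have hN : Function.HasFiniteSupport (phiTerm a N) := by
    refine hM.subset fun 𝔮 h𝔮 ↦ ?_
    rw [Function.mem_support] at h𝔮 ⊢
    exact fun h0 ↦ h𝔮 (le_antisymm ((hle 𝔮).trans (le_of_eq h0)) bot_le)
  exact finsum_le_finsum' hN hM hle

end Phi

/-! ## §4 Kato's Lemma 14.15 in a Noetherian local domain of dimension `≤ 2` -/

section Devissage

variable {A : Type u} [CommRing A] [IsNoetherianRing A] [IsLocalRing A] [IsDomain A]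
  [Ring.KrullDimLE 2 A]

/-- In a Noetherian local domain of dimension `≤ 2`, a nonzero prime of height `≠ 1` is the maximal
ideal. [folklore] -/
theorem eq_maximalIdeal_of_height_ne_one {𝔭 : PrimeSpectrum A} (h0 : 𝔭.asIdeal ≠ ⊥)
    (h1 : 𝔭.asIdeal.height ≠ 1) : 𝔭.asIdeal = IsLocalRing.maximalIdeal A := by
  by_contra hne
  have hlt : 𝔭.asIdeal < IsLocalRing.maximalIdeal A :=
    lt_of_le_of_ne (IsLocalRing.le_maximalIdeal 𝔭.isPrime.ne_top) hne
  have h𝔪 : ((IsLocalRing.maximalIdeal A).height : WithBot ℕ∞) ≤ (((2 : ℕ) : ℕ∞) : WithBot ℕ∞) := by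
    rw [IsLocalRing.maximalIdeal_height_eq_ringKrullDim]
    exact Ring.krullDimLE_iff.mp ‹Ring.KrullDimLE 2 A›
  have h𝔪' : (IsLocalRing.maximalIdeal A).height ≤ ((2 : ℕ) : ℕ∞) := WithBot.coe_le_coe.mp h𝔪
  have hup : 𝔭.asIdeal.height < ((2 : ℕ) : ℕ∞) :=
    lt_of_lt_of_le (Ideal.height_strict_mono_of_isPrime hlt) h𝔪'
  have hbot : (⊥ : Ideal A) < 𝔭.asIdeal := bot_lt_iff_ne_bot.mpr h0
  have hlow : (⊥ : Ideal A).height < 𝔭.asIdeal.height := Ideal.height_strict_mono_of_isPrime hbot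
  rw [Ideal.height_bot] at hlow
  -- `0 < h < 2`, `h ≠ 1` in `ℕ∞`: impossible
  have hne_top : 𝔭.asIdeal.height ≠ ⊤ := ne_top_of_lt hup
  obtain ⟨n, hn⟩ := ENat.ne_top_iff_exists.mp hne_top
  rw [← hn] at hlow hup h1
  have h1' : n ≠ 1 := fun h ↦ h1 (by rw [h]; rfl)
  have hup' : n < 2 := by exact_mod_cast hup
  have hlow' : 0 < n := by exact_mod_cast hlow
  omega

omit [IsNoetherianRing A] [IsDomain A] [Ring.KrullDimLE 2 A] in
/-- `ℓ_A(A/𝔪) = 1`. [folklore] -/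
theorem length_quotient_maximalIdeal :
    Module.length A (A ⧸ IsLocalRing.maximalIdeal A) = 1 := by
  rw [Module.length_eq_one_iff, isSimpleModule_iff_quot_maximal]
  exact ⟨IsLocalRing.maximalIdeal A, IsLocalRing.maximalIdeal.isMaximal A, ⟨LinearEquiv.refl _ _⟩⟩

/-- **Kato's Lemma 14.15 (Astérisque 295, p. 243–244) for a Noetherian local domain `A` of
dimension `≤ 2`, as a length identity.** Let `a ∈ 𝔪_A` and let `M` be a finitely generated
`A`-module killed by some `s ≠ 0` (i.e. torsion) such that `M_𝔮 = 0` for every height-one prime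
`𝔮 ∋ a`. Then `M/aM` and `ₐM = M[a]` have finite length and
`ℓ_A(M/aM) = ℓ_A(M[a]) + Σ_{ht 𝔮 = 1, a ∉ 𝔮} ℓ_{A_𝔮}(M_𝔮) · ℓ_A(A/(𝔮 + aA))`
— Kato's `[M/aM] − [ₐM] = Σ_𝔮 length(M_𝔮)·[A/(𝔮 + aA)]` in `G(C)`, `C` = modules of finite length
(support of codimension `≥ 2` in the two-dimensional local ring), read through `ℓ_A : G(C) → ℤ`.
Proof as printed: dévissage over a prime filtration of `M` (Mathlib's
`IsNoetherianRing.induction_on_isQuotientEquivQuotientPrime`), the two sides being additive (snake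
lemma for multiplication by `a`, resp. exactness of localisation) and equal on the graded pieces
`A/𝔮` (`𝔮` of height one with `a ∉ 𝔮`: `(A/𝔮)[a] = 0`, `(A/𝔮)/a = A/(𝔮 + aA)`) and `A/𝔪`
(both sides `1 + 0`); the pieces `A/(0)` and `A/𝔮` with `a ∈ 𝔮` are excluded by the hypotheses.
[cite: Kato2004Asterisque, Lemma 14.15 (p. 243–244)] -/
theorem length_quotSMulTop_eq_length_tors_add_Phi {a : A} (ha : a ∈ IsLocalRing.maximalIdeal A)
    {s : A} (hs : s ≠ 0) (M : Type v) [AddCommGroup M] [Module A M] [hfin : Module.Finite A M]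
    (hsM : Module.IsTorsionBy A M s)
    (hMa : ∀ 𝔮 : PrimeSpectrum A, 𝔮.asIdeal.height = 1 → a ∈ 𝔮.asIdeal → lengthAt A M 𝔮 = 0) :
    Module.length A (QuotSMulTop a M) = Module.length A (tors a M) + Phi a M ∧
      Module.length A (tors a M) ≠ ⊤ := by
  revert hsM hMa
  refine IsNoetherianRing.induction_on_isQuotientEquivQuotientPrime (A := A) hfin
    (motive := fun N _ _ _ ↦ Module.IsTorsionBy A N s →
      (∀ 𝔮 : PrimeSpectrum A, 𝔮.asIdeal.height = 1 → a ∈ 𝔮.asIdeal → lengthAt A N 𝔮 = 0) →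
      Module.length A (QuotSMulTop a N) = Module.length A (tors a N) + Phi a N ∧
        Module.length A (tors a N) ≠ ⊤) ?_ ?_ ?_
  · -- the zero module
    intro N _ _ _ _ _ _
    haveI : Subsingleton (QuotSMulTop a N) :=
      Submodule.Quotient.subsingleton_iff.mpr (Subsingleton.elim _ _)
    rw [Module.length_eq_zero (M := QuotSMulTop a N), Module.length_eq_zero (M := tors a N),
      Phi_eq_zero_of_forall fun 𝔮 _ ↦ lengthAt_eq_zero_of_subsingleton 𝔮]
    exact ⟨by simp, by simp⟩
  · -- a cyclic module `N ≃ A/𝔭`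
    intro N _ _ _ 𝔭 e hsN hNa
    -- `s` kills `A/𝔭`, so `s ∈ 𝔭` and `𝔭 ≠ 0`
    have hs𝔭 : s ∈ 𝔭.asIdeal := by
      have h1 : s • e.symm (Ideal.Quotient.mk 𝔭.asIdeal 1) = 0 := @hsN _
      rw [← LinearEquiv.map_smul, LinearEquiv.map_eq_zero_iff, Algebra.smul_def,
        Ideal.Quotient.algebraMap_eq, ← map_mul, mul_one, Ideal.Quotient.eq_zero_iff_mem] at h1
      exact h1
    have h0 : 𝔭.asIdeal ≠ ⊥ := fun h ↦ hs (by rwa [h, Ideal.mem_bot] at hs𝔭)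
    rw [(quotSMulTopEquiv e).length_eq, (torsEquiv e).length_eq, Phi_eq_of_linearEquiv e,
      (quotSMulTopQuotientEquiv 𝔭.asIdeal).length_eq]
    by_cases h1 : 𝔭.asIdeal.height = 1
    · -- height one: then `a ∉ 𝔭` (else `ℓ_𝔭(N) = 0 ≠ 1`)
      have ha𝔭 : a ∉ 𝔭.asIdeal := fun ha𝔭 ↦ by
        have := hNa 𝔭 h1 ha𝔭
        rw [lengthAt_eq_of_linearEquiv e 𝔭, lengthAt_quotient_self] at this
        exact one_ne_zero this
      rw [tors_quotient_eq_bot ha𝔭, Module.length_bot, zero_add, Phi_quotient_prime h1]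
      exact ⟨rfl, ENat.zero_ne_top⟩
    · -- otherwise `𝔭 = 𝔪 ∋ a`
      have h𝔪 := eq_maximalIdeal_of_height_ne_one h0 h1
      have ha𝔭 : a ∈ 𝔭.asIdeal := h𝔪 ▸ ha
      rw [tors_quotient_eq_top ha𝔭, (Submodule.topEquiv : _ ≃ₗ[A] A ⧸ 𝔭.asIdeal).length_eq,
        sup_eq_left.mpr ((Ideal.span_singleton_le_iff_mem _).mpr ha𝔭),
        Phi_eq_zero_of_forall, add_zero, h𝔪, length_quotient_maximalIdeal]
      · exact ⟨rfl, ENat.one_ne_top⟩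
      · intro 𝔮 h𝔮
        refine lengthAt_quotient_eq_zero_of_not_le fun hle ↦ ?_
        rw [h𝔪] at hle
        have := (IsLocalRing.maximalIdeal.isMaximal A).eq_of_le 𝔮.isPrime.ne_top hle
        rw [← h𝔪] at this
        exact h1 (this ▸ h𝔮)
  · -- a short exact sequence `0 → N₁ → N₂ → N₃ → 0`
    intro N₁ _ _ _ N₂ _ _ _ N₃ _ _ _ f g hf hg hfg ih₁ ih₃ hsN₂ hN₂a
    have hsN₁ := isTorsionBy_of_injective hsN₂ f hf
    have hsN₃ := isTorsionBy_of_surjective hsN₂ g hg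
    have hN₁a : ∀ 𝔮 : PrimeSpectrum A, 𝔮.asIdeal.height = 1 → a ∈ 𝔮.asIdeal →
        lengthAt A N₁ 𝔮 = 0 := fun 𝔮 h1 ha𝔮 ↦ by
      have := hN₂a 𝔮 h1 ha𝔮
      rw [lengthAt_eq_add_of_exact f g hf hg hfg 𝔮] at this
      exact (add_eq_zero.mp this).1
    have hN₃a : ∀ 𝔮 : PrimeSpectrum A, 𝔮.asIdeal.height = 1 → a ∈ 𝔮.asIdeal →
        lengthAt A N₃ 𝔮 = 0 := fun 𝔮 h1 ha𝔮 ↦ by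
      have := hN₂a 𝔮 h1 ha𝔮
      rw [lengthAt_eq_add_of_exact f g hf hg hfg 𝔮] at this
      exact (add_eq_zero.mp this).2
    obtain ⟨e₁, f₁⟩ := ih₁ hsN₁ hN₁a
    obtain ⟨e₃, f₃⟩ := ih₃ hsN₃ hN₃a
    have six := length_tors_quotSMulTop_of_exact (a := a) f g hf hg hfg
    have f₂ : Module.length A (tors a N₂) ≠ ⊤ :=
      ne_top_of_le_ne_top (WithTop.add_ne_top.mpr ⟨f₁, f₃⟩)
        (length_tors_le_of_exact (a := a) f g hf hfg)
    refine ⟨?_, f₂⟩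
    rw [Phi_eq_add_of_exact hs hsN₂ f g hf hg hfg]
    rw [e₁, e₃] at six
    -- cancel the finite quantity `ℓ(N₁[a]) + ℓ(N₃[a])`
    have hfin : Module.length A (tors a N₁) + Module.length A (tors a N₃) ≠ ⊤ :=
      WithTop.add_ne_top.mpr ⟨f₁, f₃⟩
    have key : Module.length A (tors a N₁) + Module.length A (tors a N₃) +
        (Module.length A (tors a N₂) + (Phi a N₁ + Phi a N₃)) =
        Module.length A (tors a N₁) + Module.length A (tors a N₃) +
          Module.length A (QuotSMulTop a N₂) := by
      rw [← six]
      ring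
    exact (WithTop.add_left_cancel hfin key).symm

/-- The same with `Module.IsTorsion` in place of an explicit killing element. [cite: Kato2004Asterisque, Lemma 14.15 (p. 243–244)] -/
theorem length_quotSMulTop_eq_length_tors_add_Phi' {a : A} (ha : a ∈ IsLocalRing.maximalIdeal A)
    (M : Type v) [AddCommGroup M] [Module A M] [Module.Finite A M] (hM : Module.IsTorsion A M)
    (hMa : ∀ 𝔮 : PrimeSpectrum A, 𝔮.asIdeal.height = 1 → a ∈ 𝔮.asIdeal → lengthAt A M 𝔮 = 0) :
    Module.length A (QuotSMulTop a M) = Module.length A (tors a M) + Phi a M ∧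
      Module.length A (tors a M) ≠ ⊤ := by
  obtain ⟨s, hsann, hs0⟩ := Submodule.annihilator_top_inter_nonZeroDivisors hM
  exact length_quotSMulTop_eq_length_tors_add_Phi ha (nonZeroDivisors.ne_zero hs0) M
    (fun x ↦ Submodule.mem_annihilator.mp hsann x Submodule.mem_top) hMa

end Devissage

end Summit.BirchSwinnertonDyer.BirchSwinnertonDyer.Theorems.KatoDescent

end
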